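import Summits.Ventures.CertifiedManyBodySolver.Upper.BlochDecorrelation
import Summits.Ventures.CertifiedManyBodySolver.Upper.BlochDressedMixture
import HarnessLib

/-!
# Ventures/CertifiedManyBodySolver — Upper/BlochDressedBound.lean

HONEST FRAMING: first certified bounds; not a superconductivity verdict; every number certified or labelled float.

THE PLAQUETTE-DRESSED BLOCH BOUND FOR NON-IDEMPOTENT BLOCKS ON A FINITE TORUS (sr-mbsolver L3 engine seat E1; steps D1+D2 of
the Lean route for the plaquette-dressed translation-invariant quasi-free uppers, eng-1/LEAN-GLUE-QF.md §4, combined; theorem-only,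
no certificate value appears, nothing is claimed). On the torus `(ℤ/2m)²` (`m ≥ 2`) with a magnetic cell `k i · M i = 2m`, blocks
`Q σ κ` with spectra in `[0,1]`, mean filling `n̄ ∈ (0,2)`, `U ≥ 0`, and one layer of number-conserving plaquette unitaries `u_c`:

  `e(t,U;n̄) ≤ re 𝒟_u(P_Q)/(2m)² + [ (Σ_c ‖u_cᴴ H_plaq u_c‖₁)·K₈ + (Σ_ℓ ‖V_ℓᴴ T_ℓ V_ℓ‖₁)·K₁₆ ] / (2m)² + 16|t|/(2m)`,

where `𝒟_u(P)` is the dressed Slater functional of `PlaquetteLUC.groundEnergyAt_le_dressed` (plaquette terms in the window reduced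
density matrices `slaterRDM (P|_cell c)` plus link terms), `P_Q = spinBlock (σ ↦ blochMatrix Q_σ)` the (NON-idempotent) collinear
one-body matrix of the reference, `‖X‖₁ = Σ_{s,s'} |X_{ss'}|`, and `K_w = 2^w · w! · 2w² / |k|` (`w = 8` orbitals for a plaquette window,
`16` for a link window; `|k|` = number of magnetic cells). Proof: `energyDensity2D_le_avg_dressed` (the member bounds averaged over the
product-Bernoulli mixture, `Upper/BlochDressedMixture.lean`) and the decorrelation of window observables
(`norm_sum_prodWeight_mul_windowObservable_sub_le`, `Upper/BlochDecorrelation.lean`), cluster by cluster. Along a thermodynamic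
sequence `m_j = j·m₀` with the cell fixed, `|k| → ∞` and both error terms vanish (next file: cell periodicity of `𝒟_u(P_Q)` and the
limit). Sources: Lieb 1981 [Lieb1981]; Bach–Lieb–Solovej 1994 (2c.36), Thm 2.3 [BachLiebSolovej1994]. Everything proved; no definition.
-/

noncomputable section

namespace Summit.Ventures.CertifiedManyBodySolver.Upper

open Matrix Finset
open Literature.MathematicalPhysics.QuantumLattice Literature.MathematicalPhysics.QuantumLattice.HartreeFock
  Literature.MathematicalPhysics.QuantumLattice.ThermodynamicLimit HubbardWave0 PlaquetteLUC
open scoped ComplexOrder ComplexConjugate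

variable {m : ℕ} [NeZero m] {k M : Fin 2 → ℕ} [∀ i, NeZero (k i)] [∀ i, NeZero (M i)]

/-- Decorrelation of a SUM of window observables indexed by clusters `c ∈ C` (windows `f c`, coefficient matrices `X c`, double-sum
form): the product-Bernoulli average differs from the value at `P_Q` by at most `(Σ_c ‖X c‖₁) · 2^w w! 2w² / |k|`. [folklore] -/
theorem norm_sum_prodWeight_mul_sum_windowObservable_sub_le {L : ℕ} (hkM : ∀ i, k i * M i = L)
    (Q : Fin 2 → RectTorusSite k → Matrix (RectTorusSite M) (RectTorusSite M) ℂ) (hQh : ∀ σ κ, (Q σ κ).IsHermitian)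
    (h0 : ∀ σ κ i, 0 ≤ (hQh σ κ).eigenvalues i) (h1 : ∀ σ κ i, (hQh σ κ).eigenvalues i ≤ 1)
    {Λ₀ : Type*} [LinearOrder Λ₀] [Fintype Λ₀] {C : Type*} [Fintype C] (f : C → Orb Λ₀ → Orb (FermionTorus 2 L))
    (X : C → Matrix (Finset (Orb Λ₀)) (Finset (Orb Λ₀)) ℂ) :
    ‖(∑ E : Fin 2 × RectTorusSite k → RectTorusSite M → Bool,
        (∏ b : Fin 2 × RectTorusSite k, (bernoulliWeight (hQh b.1 b.2) (E b) : ℂ)) *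
          ∑ c, ∑ s : Finset (Orb Λ₀), ∑ s' : Finset (Orb Λ₀), X c s s' *
            slaterRDM ((spinBlock fun σ => blochMatrix hkM fun κ => bernoulliProj (hQh σ κ) (E (σ, κ))).submatrix (f c) (f c)) s s') -
        ∑ c, ∑ s : Finset (Orb Λ₀), ∑ s' : Finset (Orb Λ₀), X c s s' *
          slaterRDM ((spinBlock fun σ => blochMatrix hkM (Q σ)).submatrix (f c) (f c)) s s'‖ ≤
      (∑ c, ∑ s : Finset (Orb Λ₀), ∑ s' : Finset (Orb Λ₀), ‖X c s s'‖) *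
        (2 ^ Fintype.card (Orb Λ₀) * ((Fintype.card (Orb Λ₀)).factorial *
          (2 * (Fintype.card (Orb Λ₀) : ℝ) ^ 2 / (Fintype.card (RectTorusSite k) : ℝ)))) := by
  -- abbreviations
  obtain ⟨W, hW⟩ : ∃ W : (Fin 2 × RectTorusSite k → RectTorusSite M → Bool) → ℂ,
      W = fun E => ∏ b : Fin 2 × RectTorusSite k, (bernoulliWeight (hQh b.1 b.2) (E b) : ℂ) := ⟨_, rfl⟩
  obtain ⟨K, hK⟩ : ∃ K : ℝ, K = 2 ^ Fintype.card (Orb Λ₀) * ((Fintype.card (Orb Λ₀)).factorial *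
      (2 * (Fintype.card (Orb Λ₀) : ℝ) ^ 2 / (Fintype.card (RectTorusSite k) : ℝ))) := ⟨_, rfl⟩
  obtain ⟨A, hA⟩ : ∃ A : (Fin 2 × RectTorusSite k → RectTorusSite M → Bool) → C → ℂ, A = fun E c =>
      ∑ st : Finset (Orb Λ₀) × Finset (Orb Λ₀), X c st.1 st.2 *
        slaterRDM ((spinBlock fun σ => blochMatrix hkM fun κ => bernoulliProj (hQh σ κ) (E (σ, κ))).submatrix (f c) (f c)) st.1 st.2 :=
    ⟨_, rfl⟩
  obtain ⟨B, hB⟩ : ∃ B : C → ℂ, B = fun c => ∑ st : Finset (Orb Λ₀) × Finset (Orb Λ₀), X c st.1 st.2 *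
      slaterRDM ((spinBlock fun σ => blochMatrix hkM (Q σ)).submatrix (f c) (f c)) st.1 st.2 := ⟨_, rfl⟩
  have hδ : ∀ c, ‖(∑ E, W E * A E c) - B c‖ ≤ (∑ st : Finset (Orb Λ₀) × Finset (Orb Λ₀), ‖X c st.1 st.2‖) * K := by
    intro c
    rw [hW, hA, hB, hK]
    exact norm_sum_prodWeight_mul_windowObservable_sub_le hkM Q hQh h0 h1 (f c) (X c)
  -- double sums are pair sums
  have e1 : ∀ g : Finset (Orb Λ₀) → Finset (Orb Λ₀) → ℂ,
      ∑ s, ∑ s', g s s' = ∑ st : Finset (Orb Λ₀) × Finset (Orb Λ₀), g st.1 st.2 := fun g => (Fintype.sum_prod_type' g).symm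
  have e2 : ∀ g : Finset (Orb Λ₀) → Finset (Orb Λ₀) → ℝ,
      ∑ s, ∑ s', g s s' = ∑ st : Finset (Orb Λ₀) × Finset (Orb Λ₀), g st.1 st.2 := fun g => (Fintype.sum_prod_type' g).symm
  have hAE : ∀ (E : Fin 2 × RectTorusSite k → RectTorusSite M → Bool) (c : C),
      (∑ s : Finset (Orb Λ₀), ∑ s' : Finset (Orb Λ₀), X c s s' *
        slaterRDM ((spinBlock fun σ => blochMatrix hkM fun κ => bernoulliProj (hQh σ κ) (E (σ, κ))).submatrix (f c) (f c)) s s') =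
      A E c := fun E c => by rw [hA]; exact e1 _
  have hBc : ∀ c : C, (∑ s : Finset (Orb Λ₀), ∑ s' : Finset (Orb Λ₀), X c s s' *
      slaterRDM ((spinBlock fun σ => blochMatrix hkM (Q σ)).submatrix (f c) (f c)) s s') = B c := fun c => by rw [hB]; exact e1 _
  have hXc : ∀ c : C, (∑ s : Finset (Orb Λ₀), ∑ s' : Finset (Orb Λ₀), ‖X c s s'‖) =
      ∑ st : Finset (Orb Λ₀) × Finset (Orb Λ₀), ‖X c st.1 st.2‖ := fun c => e2 _
  have hWE : ∀ E : Fin 2 × RectTorusSite k → RectTorusSite M → Bool,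
      (∏ b : Fin 2 × RectTorusSite k, (bernoulliWeight (hQh b.1 b.2) (E b) : ℂ)) = W E := fun E => by rw [hW]
  simp_rw [hWE, hAE, hBc, hXc]
  rw [← hK]
  -- linearity in `c`
  have hlin : (∑ E, W E * ∑ c, A E c) - ∑ c, B c = ∑ c, ((∑ E, W E * A E c) - B c) := by
    simp_rw [Finset.mul_sum]
    rw [Finset.sum_comm, ← Finset.sum_sub_distrib]
  rw [hlin, Finset.sum_mul]
  exact (norm_sum_le _ _).trans (Finset.sum_le_sum fun c _ => hδ c)

/-- **The plaquette-dressed Bloch bound for non-idempotent blocks.** On `(ℤ/2m)²`, `m ≥ 2`, magnetic cell `k i · M i = 2m`, blocks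
`Q σ κ` with spectra in `[0,1]`, `n̄ = re Σ tr Q σ κ /(2m)² ∈ (0,2)`, `U ≥ 0`, number-conserving plaquette unitaries `u_c`:
`e(t,U;n̄) ≤ re 𝒟_u(P_Q)/(2m)² + [(Σ_c ‖u_cᴴ H_plaq u_c‖₁) K₈ + (Σ_ℓ ‖V_ℓᴴ T_ℓ V_ℓ‖₁) K₁₆]/(2m)² + 16|t|/(2m)` with
`K_w = 2^w w! 2w²/|k|`. (Member bounds averaged over the product-Bernoulli mixture, then decorrelation cluster by cluster.)
[cite: BachLiebSolovej1994, eq. (2c.36)] -/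
theorem energyDensity2D_le_dressed_bloch (hm : 2 ≤ m) (hkM : ∀ i, k i * M i = m * 2) (t : ℝ) {U : ℝ} (hU : 0 ≤ U)
    (Q : Fin 2 → RectTorusSite k → Matrix (RectTorusSite M) (RectTorusSite M) ℂ) (hQh : ∀ σ κ, (Q σ κ).IsHermitian)
    (h0 : ∀ σ κ i, 0 ≤ (hQh σ κ).eigenvalues i) (h1 : ∀ σ κ i, (hQh σ κ).eigenvalues i ≤ 1)
    (hn0 : 0 < (∑ σ, ∑ κ, (Q σ κ).trace).re / ((m * 2 : ℕ) : ℝ) ^ 2)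
    (hn2 : (∑ σ, ∑ κ, (Q σ κ).trace).re / ((m * 2 : ℕ) : ℝ) ^ 2 < 2)
    (u : (Fin 2 → Fin m) → Matrix (Finset (Orb (FermionTorus 2 2))) (Finset (Orb (FermionTorus 2 2))) ℂ)
    (hu : ∀ c, (u c)ᴴ * u c = 1) (huN : ∀ c, Commute totalNumberOp (u c)) :
    energyDensity2D t U ((∑ σ, ∑ κ, (Q σ κ).trace).re / ((m * 2 : ℕ) : ℝ) ^ 2) ≤
      ((∑ c : Fin 2 → Fin m, ∑ s : Finset (Orb (FermionTorus 2 2)), ∑ s' : Finset (Orb (FermionTorus 2 2)),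
            ((u c)ᴴ * hamiltonian plaquetteGraph t U * u c) s s' *
              slaterRDM ((spinBlock fun σ => blochMatrix hkM (Q σ)).submatrix
                (fun a => orb (cellEmb c (ofLex a).1) (ofLex a).2) (fun a => orb (cellEmb c (ofLex a).1) (ofLex a).2)) s s') +
          ∑ ℓ : (Fin 2 → Fin m) × Fin 2, ∑ s : Finset (Orb (Fin 2 ×ₗ FermionTorus 2 2)), ∑ s' : Finset (Orb (Fin 2 ×ₗ FermionTorus 2 2)),
            ((fermionEmbed inlCell (u ℓ.1) * fermionEmbed inrCell (u (shiftCell ℓ.1 ℓ.2)))ᴴ * hamiltonian (linkGraph ℓ.2) t 0 *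
                (fermionEmbed inlCell (u ℓ.1) * fermionEmbed inrCell (u (shiftCell ℓ.1 ℓ.2)))) s s' *
              slaterRDM ((spinBlock fun σ => blochMatrix hkM (Q σ)).submatrix
                (fun a => orb (linkEmb hm ℓ.1 ℓ.2 (ofLex a).1) (ofLex a).2) (fun a => orb (linkEmb hm ℓ.1 ℓ.2 (ofLex a).1) (ofLex a).2)) s s').re /
          ((m * 2 : ℕ) : ℝ) ^ 2 +
        ((∑ c : Fin 2 → Fin m, ∑ s : Finset (Orb (FermionTorus 2 2)), ∑ s' : Finset (Orb (FermionTorus 2 2)),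
              ‖((u c)ᴴ * hamiltonian plaquetteGraph t U * u c) s s'‖) *
            (2 ^ Fintype.card (Orb (FermionTorus 2 2)) * ((Fintype.card (Orb (FermionTorus 2 2))).factorial *
              (2 * (Fintype.card (Orb (FermionTorus 2 2)) : ℝ) ^ 2 / (Fintype.card (RectTorusSite k) : ℝ)))) +
          (∑ ℓ : (Fin 2 → Fin m) × Fin 2, ∑ s : Finset (Orb (Fin 2 ×ₗ FermionTorus 2 2)), ∑ s' : Finset (Orb (Fin 2 ×ₗ FermionTorus 2 2)),
              ‖((fermionEmbed inlCell (u ℓ.1) * fermionEmbed inrCell (u (shiftCell ℓ.1 ℓ.2)))ᴴ * hamiltonian (linkGraph ℓ.2) t 0 *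
                (fermionEmbed inlCell (u ℓ.1) * fermionEmbed inrCell (u (shiftCell ℓ.1 ℓ.2)))) s s'‖) *
            (2 ^ Fintype.card (Orb (Fin 2 ×ₗ FermionTorus 2 2)) * ((Fintype.card (Orb (Fin 2 ×ₗ FermionTorus 2 2))).factorial *
              (2 * (Fintype.card (Orb (Fin 2 ×ₗ FermionTorus 2 2)) : ℝ) ^ 2 / (Fintype.card (RectTorusSite k) : ℝ))))) /
          ((m * 2 : ℕ) : ℝ) ^ 2 +
        16 * |t| / ((m * 2 : ℕ) : ℝ) := by
  have havg := energyDensity2D_le_avg_dressed hm hkM t hU Q hQh h0 h1 hn0 hn2 u hu huN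
  have hL2 : (0 : ℝ) < ((m * 2 : ℕ) : ℝ) ^ 2 := by
    have : (0 : ℝ) < ((m * 2 : ℕ) : ℝ) := by exact_mod_cast (show 0 < m * 2 by omega)
    positivity
  -- abbreviations for the coefficient matrices, the windows and the two cluster sums
  obtain ⟨Xc, hXc⟩ : ∃ Xc : (Fin 2 → Fin m) → Matrix (Finset (Orb (FermionTorus 2 2))) (Finset (Orb (FermionTorus 2 2))) ℂ,
      Xc = fun c => (u c)ᴴ * hamiltonian plaquetteGraph t U * u c := ⟨_, rfl⟩
  obtain ⟨Yl, hYl⟩ : ∃ Yl : (Fin 2 → Fin m) × Fin 2 →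
      Matrix (Finset (Orb (Fin 2 ×ₗ FermionTorus 2 2))) (Finset (Orb (Fin 2 ×ₗ FermionTorus 2 2))) ℂ,
      Yl = fun ℓ => (fermionEmbed inlCell (u ℓ.1) * fermionEmbed inrCell (u (shiftCell ℓ.1 ℓ.2)))ᴴ * hamiltonian (linkGraph ℓ.2) t 0 *
        (fermionEmbed inlCell (u ℓ.1) * fermionEmbed inrCell (u (shiftCell ℓ.1 ℓ.2))) := ⟨_, rfl⟩
  obtain ⟨fc, hfc⟩ : ∃ fc : (Fin 2 → Fin m) → Orb (FermionTorus 2 2) → Orb (FermionTorus 2 (m * 2)),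
      fc = fun c a => orb (cellEmb c (ofLex a).1) (ofLex a).2 := ⟨_, rfl⟩
  obtain ⟨fl, hfl⟩ : ∃ fl : (Fin 2 → Fin m) × Fin 2 → Orb (Fin 2 ×ₗ FermionTorus 2 2) → Orb (FermionTorus 2 (m * 2)),
      fl = fun ℓ a => orb (linkEmb hm ℓ.1 ℓ.2 (ofLex a).1) (ofLex a).2 := ⟨_, rfl⟩
  have eXc : ∀ c, (u c)ᴴ * hamiltonian plaquetteGraph t U * u c = Xc c := fun c => by rw [hXc]
  have eYl : ∀ ℓ : (Fin 2 → Fin m) × Fin 2,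
      (fermionEmbed inlCell (u ℓ.1) * fermionEmbed inrCell (u (shiftCell ℓ.1 ℓ.2)))ᴴ * hamiltonian (linkGraph ℓ.2) t 0 *
        (fermionEmbed inlCell (u ℓ.1) * fermionEmbed inrCell (u (shiftCell ℓ.1 ℓ.2))) = Yl ℓ := fun ℓ => by rw [hYl]
  have efc : ∀ c, (fun a : Orb (FermionTorus 2 2) => orb (cellEmb c (ofLex a).1) (ofLex a).2) = fc c := fun c => by rw [hfc]
  have efl : ∀ ℓ : (Fin 2 → Fin m) × Fin 2,
      (fun a : Orb (Fin 2 ×ₗ FermionTorus 2 2) => orb (linkEmb hm ℓ.1 ℓ.2 (ofLex a).1) (ofLex a).2) = fl ℓ := fun ℓ => by rw [hfl]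
  simp_rw [eXc, eYl, efc, efl] at havg ⊢
  -- the two decorrelation bounds
  have hcells := norm_sum_prodWeight_mul_sum_windowObservable_sub_le hkM Q hQh h0 h1 fc Xc
  have hlinks := norm_sum_prodWeight_mul_sum_windowObservable_sub_le hkM Q hQh h0 h1 fl Yl
  -- abbreviate the averaged quantities
  obtain ⟨W, hW⟩ : ∃ W : (Fin 2 × RectTorusSite k → RectTorusSite M → Bool) → ℝ,
      W = fun E => ∏ b : Fin 2 × RectTorusSite k, bernoulliWeight (hQh b.1 b.2) (E b) := ⟨_, rfl⟩
  obtain ⟨A, hA⟩ : ∃ A : (Fin 2 × RectTorusSite k → RectTorusSite M → Bool) → ℂ, A = fun E =>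
      ∑ c, ∑ s : Finset (Orb (FermionTorus 2 2)), ∑ s' : Finset (Orb (FermionTorus 2 2)), Xc c s s' *
        slaterRDM ((spinBlock fun σ => blochMatrix hkM fun κ => bernoulliProj (hQh σ κ) (E (σ, κ))).submatrix (fc c) (fc c)) s s' :=
    ⟨_, rfl⟩
  obtain ⟨B, hB⟩ : ∃ B : (Fin 2 × RectTorusSite k → RectTorusSite M → Bool) → ℂ, B = fun E =>
      ∑ ℓ, ∑ s : Finset (Orb (Fin 2 ×ₗ FermionTorus 2 2)), ∑ s' : Finset (Orb (Fin 2 ×ₗ FermionTorus 2 2)), Yl ℓ s s' *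
        slaterRDM ((spinBlock fun σ => blochMatrix hkM fun κ => bernoulliProj (hQh σ κ) (E (σ, κ))).submatrix (fl ℓ) (fl ℓ)) s s' :=
    ⟨_, rfl⟩
  obtain ⟨AQ, hAQ⟩ : ∃ AQ : ℂ, AQ = ∑ c, ∑ s : Finset (Orb (FermionTorus 2 2)), ∑ s' : Finset (Orb (FermionTorus 2 2)), Xc c s s' *
      slaterRDM ((spinBlock fun σ => blochMatrix hkM (Q σ)).submatrix (fc c) (fc c)) s s' := ⟨_, rfl⟩
  obtain ⟨BQ, hBQ⟩ : ∃ BQ : ℂ, BQ = ∑ ℓ, ∑ s : Finset (Orb (Fin 2 ×ₗ FermionTorus 2 2)), ∑ s' : Finset (Orb (Fin 2 ×ₗ FermionTorus 2 2)),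
      Yl ℓ s s' * slaterRDM ((spinBlock fun σ => blochMatrix hkM (Q σ)).submatrix (fl ℓ) (fl ℓ)) s s' := ⟨_, rfl⟩
  obtain ⟨K₁, hK₁⟩ : ∃ K₁ : ℝ, K₁ = (∑ c, ∑ s : Finset (Orb (FermionTorus 2 2)), ∑ s' : Finset (Orb (FermionTorus 2 2)), ‖Xc c s s'‖) *
      (2 ^ Fintype.card (Orb (FermionTorus 2 2)) * ((Fintype.card (Orb (FermionTorus 2 2))).factorial *
        (2 * (Fintype.card (Orb (FermionTorus 2 2)) : ℝ) ^ 2 / (Fintype.card (RectTorusSite k) : ℝ)))) := ⟨_, rfl⟩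
  obtain ⟨K₂, hK₂⟩ : ∃ K₂ : ℝ, K₂ = (∑ ℓ : (Fin 2 → Fin m) × Fin 2, ∑ s : Finset (Orb (Fin 2 ×ₗ FermionTorus 2 2)),
      ∑ s' : Finset (Orb (Fin 2 ×ₗ FermionTorus 2 2)), ‖Yl ℓ s s'‖) *
      (2 ^ Fintype.card (Orb (Fin 2 ×ₗ FermionTorus 2 2)) * ((Fintype.card (Orb (Fin 2 ×ₗ FermionTorus 2 2))).factorial *
        (2 * (Fintype.card (Orb (Fin 2 ×ₗ FermionTorus 2 2)) : ℝ) ^ 2 / (Fintype.card (RectTorusSite k) : ℝ)))) := ⟨_, rfl⟩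
  have hWc : ∀ E : Fin 2 × RectTorusSite k → RectTorusSite M → Bool,
      (∏ b : Fin 2 × RectTorusSite k, (bernoulliWeight (hQh b.1 b.2) (E b) : ℂ)) = ((W E : ℝ) : ℂ) := fun E => by
    rw [hW]; push_cast; rfl
  have hWE : ∀ E : Fin 2 × RectTorusSite k → RectTorusSite M → Bool,
      (∏ b : Fin 2 × RectTorusSite k, bernoulliWeight (hQh b.1 b.2) (E b)) = W E := fun E => by rw [hW]
  have hAE : ∀ E : Fin 2 × RectTorusSite k → RectTorusSite M → Bool,
      (∑ c, ∑ s : Finset (Orb (FermionTorus 2 2)), ∑ s' : Finset (Orb (FermionTorus 2 2)), Xc c s s' *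
        slaterRDM ((spinBlock fun σ => blochMatrix hkM fun κ => bernoulliProj (hQh σ κ) (E (σ, κ))).submatrix (fc c) (fc c)) s s') =
      A E := fun E => by rw [hA]
  have hBE : ∀ E : Fin 2 × RectTorusSite k → RectTorusSite M → Bool,
      (∑ ℓ, ∑ s : Finset (Orb (Fin 2 ×ₗ FermionTorus 2 2)), ∑ s' : Finset (Orb (Fin 2 ×ₗ FermionTorus 2 2)), Yl ℓ s s' *
        slaterRDM ((spinBlock fun σ => blochMatrix hkM fun κ => bernoulliProj (hQh σ κ) (E (σ, κ))).submatrix (fl ℓ) (fl ℓ)) s s') =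
      B E := fun E => by rw [hB]
  simp_rw [hWc, hAE, hBE] at hcells hlinks
  simp_rw [hWE, hAE, hBE] at havg
  rw [← hAQ, ← hK₁] at hcells
  rw [← hBQ, ← hK₂] at hlinks
  rw [← hAQ, ← hBQ, ← hK₁, ← hK₂]
  -- compare the average with the value at `P_Q`
  have hre : ∑ E, W E * (A E + B E).re = ((AQ + BQ) + (((∑ E, ((W E : ℝ) : ℂ) * A E) - AQ) + ((∑ E, ((W E : ℝ) : ℂ) * B E) - BQ))).re := by
    have : (AQ + BQ) + (((∑ E, ((W E : ℝ) : ℂ) * A E) - AQ) + ((∑ E, ((W E : ℝ) : ℂ) * B E) - BQ)) =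
        ∑ E, ((W E : ℝ) : ℂ) * (A E + B E) := by
      simp_rw [mul_add]
      rw [Finset.sum_add_distrib]
      ring
    rw [this, Complex.re_sum]
    exact Finset.sum_congr rfl fun E _ => by rw [Complex.re_ofReal_mul]
  have hbound : ∑ E, W E * (A E + B E).re ≤ (AQ + BQ).re + (K₁ + K₂) := by
    rw [hre, Complex.add_re]
    have h := Complex.re_le_norm (((∑ E, ((W E : ℝ) : ℂ) * A E) - AQ) + ((∑ E, ((W E : ℝ) : ℂ) * B E) - BQ))
    have h' := norm_add_le ((∑ E, ((W E : ℝ) : ℂ) * A E) - AQ) ((∑ E, ((W E : ℝ) : ℂ) * B E) - BQ)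
    linarith
  have hdiv := div_le_div_of_nonneg_right hbound hL2.le
  rw [add_div] at hdiv
  linarith

end Summit.Ventures.CertifiedManyBodySolver.Upper
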